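import Summits.Ventures.PercRepro.S1CoreCapSixCost

/-!
# PercRepro — TOWARDS `Q*(6) = 16`: NO BIG LINE, WEIGHTS `≤ 4` (p1, gen 25)

The case of a configuration of 3-point lines with at most one fat point each (weight `≤ 4`) at nullity `6`: the
setting of `S1CoreCapSpecFiveThin` with budget `6` over nothing (`budget_six`) and budget `5` over any one line
(`budget_line`). With no fat point there are `≤ 1 + 15` lines (free budget `5` over a line); with one fat point
`p` on `A`, `≤ 1 + 10` lines (free budget `4` over `A`, which carries `p`) and `≤ 5` through `p`; with two fat
points `≤ 3` lines through each, `≤ 3` lines avoiding the second beside `A`, `≤ 7` in all; with three fat points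
`≤ 1` line through each and every line through one of them (`deg_le_one_of_three_fat`, `through_of_three_fat`);
four fat points cost `4 + 4` (`not_four_fat`). The cap sum is `#lines + Σ deg` and is `≤ 16` in every case, with
equality reached twice in the count (`sum_cap_le_sixteen_of_thin`). `proofs/P1-S4-CAPBRIDGE.md` §17.
Axioms: standard.
-/

namespace PercRepro

namespace S1

namespace FourCap

variable {β : Type} [DecidableEq β]

section Thin6

variable {w : β → ℕ} {ls : Finset (Finset β)}
  (h1 : ∀ L ∈ ls, ∀ v ∈ L, w v = 1 ∨ w v = 2)
  (h2 : ∀ L ∈ ls, 3 ≤ L.card ∧ wsum w L ≤ 5)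
  (h3 : ∀ L ∈ ls, ∀ L' ∈ ls, L ≠ L' → (L ∩ L').card ≤ 1)
  (h4 : ∀ l : List (Finset β), l.Nodup → (∀ L ∈ l, L ∈ ls) → wsum w (unionL l) ≤ 6 + lineRank l)
  (hall : ∀ L ∈ ls, L.card = 3)
  (hw4 : ∀ L ∈ ls, wsum w L ≤ 4)

include h1 h2 h4 hall in
/-- **Budget `6` over nothing.** -/
theorem budget_six (l : List (Finset β)) (hnd : l.Nodup) (hl : ∀ L ∈ l, L ∈ ls) :
    freeCountR ∅ l + fat w (unionLR ∅ l) ≤ 6 := by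
  have h := budget_of_prefix h1 (fun L hL => le_trans (by omega) (h2 L hL).1) h4 [] l (by simpa using hnd)
    (by simpa using hl) (fun L hL => hall L (hl L hL))
  simp only [costSum, unionL, fat, Finset.filter_empty, Finset.card_empty, Nat.zero_add, Nat.add_zero] at h
  simpa [fat] using h

include h1 h2 h4 hall in
/-- **Budget `5` over one line.** -/
theorem budget_line {L₀ : Finset β} (hL₀ : L₀ ∈ ls) (l : List (Finset β)) (hnd : l.Nodup) (hL₀l : L₀ ∉ l)
    (hl : ∀ L ∈ l, L ∈ ls) : freeCountR L₀ l + fat w (unionLR L₀ l) ≤ 5 := by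
  have hnd' : (l ++ [L₀]).Nodup :=
    List.Nodup.append hnd (List.nodup_singleton _) (fun a ha hb => hL₀l (List.mem_singleton.1 hb ▸ ha))
  have hl' : ∀ L ∈ l ++ [L₀], L ∈ ls := by
    intro L hL
    rcases List.mem_append.1 hL with h | h
    · exact hl L h
    · rw [List.mem_singleton.1 h]; exact hL₀
  have h := budget_of_prefix h1 (fun L hL => le_trans (by omega) (h2 L hL).1) h4 [L₀] l hnd' hl'
    (fun L hL => hall L (hl L hL))
  simp only [costSum, unionL, Finset.union_empty, Nat.zero_add] at h
  rw [lineCost_empty, hall L₀ hL₀] at h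
  omega

include h3 hall in
/-- The lines beside `L₀` under a free budget `k` over `L₀`: `2 · #ls ≤ 2 + k (k + 1)`. -/
theorem hover (L₀ : Finset β) (hL₀ : L₀ ∈ ls) (k : ℕ)
    (hk : ∀ l : List (Finset β), l.Nodup → (∀ L ∈ l, L ∈ ls.erase L₀) → freeCountR L₀ l ≤ k) :
    2 * ls.card ≤ 2 + k * (k + 1) := by
  have h := two_mul_card_le_of_freeCountR L₀ k (ls.erase L₀)
    (fun L hL => ⟨hall L (Finset.mem_erase.1 hL).2, h3 L (Finset.mem_erase.1 hL).2 L₀ hL₀ (Finset.mem_erase.1 hL).1⟩)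
    (fun L hL L' hL' hne => h3 L (Finset.mem_erase.1 hL).2 L' (Finset.mem_erase.1 hL').2 hne) hk
  rw [Finset.card_erase_of_mem hL₀] at h
  have := Finset.card_pos.2 ⟨L₀, hL₀⟩
  omega

include h1 h2 h3 h4 hall hw4 in
/-- **Three fat points: `≤ 1` line through each** — the lines through `p` and the lines of `q, r` are a free
sequence bringing three fat points. -/
theorem deg_le_one_of_three_fat {p q r : β} (hp2 : w p = 2) (hq2 : w q = 2) (hr2 : w r = 2) (hpq : p ≠ q)
    (hpr : p ≠ r) (hqr : q ≠ r) {B C : Finset β} (hB : B ∈ ls) (hqB : q ∈ B) (hC : C ∈ ls) (hrC : r ∈ C) :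
    (ls.filter (fun L => p ∈ L)).card ≤ 1 := by
  set D := ls.filter (fun L => p ∈ L) with hD
  have hmem : ∀ L ∈ D.toList, L ∈ ls ∧ p ∈ L := fun L hL => Finset.mem_filter.1 (Finset.mem_toList.1 hL)
  have hnot : ∀ L ∈ ls, ∀ x y : β, x ∈ L → y ∈ L → x ≠ y → w x = 2 → w y = 2 → False := fun L hL x y hx hy hxy hx2 hy2 =>
    two_fat_false (h1 L hL) (hw4 L hL) (by rw [hall L hL]) hx hy hxy hx2 hy2
  have hqD : ∀ L ∈ D.toList, q ∉ L := fun L hL h => hnot L (hmem L hL).1 p q (hmem L hL).2 h hpq hp2 hq2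
  have hrD : ∀ L ∈ D.toList, r ∉ L := fun L hL h => hnot L (hmem L hL).1 p r (hmem L hL).2 h hpr hp2 hr2
  have hpB : p ∉ B := fun h => hnot B hB p q h hqB hpq hp2 hq2
  have hrB : r ∉ B := fun h => hnot B hB q r hqB h hqr hq2 hr2
  have hpC : p ∉ C := fun h => hnot C hC p r h hrC hpr hp2 hr2
  have hBD : B ∉ D.toList := fun h => hpB (hmem B h).2
  have hCD : C ∉ D.toList := fun h => hpC (hmem C h).2
  have hCB : C ≠ B := fun h => hrB (h ▸ hrC)
  have h := budget_six h1 h2 h4 hall (C :: B :: D.toList)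
    (List.nodup_cons.2 ⟨by simp [hCB, hCD], List.nodup_cons.2 ⟨hBD, Finset.nodup_toList D⟩⟩)
    (fun L hL => by
      rcases List.mem_cons.1 hL with rfl | hL
      · exact hC
      rcases List.mem_cons.1 hL with rfl | hL
      · exact hB
      · exact (hmem L hL).1)
  rw [freeCountR_cons_of_new hrC (Finset.notMem_empty r) (fun L hL hrL => by
      rcases List.mem_cons.1 hL with rfl | hL
      · exact hrB hrL
      · exact hrD L hL hrL),
    freeCountR_cons_of_new hqB (Finset.notMem_empty q) hqD,
    freeCountR_eq_length_of_mem' ∅ D.toList (Finset.nodup_toList D)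
      (fun L hL => ⟨hall L (hmem L hL).1, (hmem L hL).2, by simp⟩)
      (fun L hL L' hL' hne => h3 L (hmem L hL).1 L' (hmem L' hL').1 hne), Finset.length_toList] at h
  rcases Finset.eq_empty_or_nonempty D with hempty | ⟨A, hA⟩
  · rw [hempty]; simp
  have hpU : p ∈ unionLR ∅ (C :: B :: D.toList) :=
    mem_unionLR_of_mem (List.mem_cons_of_mem _ (List.mem_cons_of_mem _ (Finset.mem_toList.2 hA)))
      (Finset.mem_filter.1 hA).2
  have hqU : q ∈ unionLR ∅ (C :: B :: D.toList) := mem_unionLR_of_mem (List.mem_cons_of_mem _ List.mem_cons_self) hqB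
  have hrU : r ∈ unionLR ∅ (C :: B :: D.toList) := mem_unionLR_of_mem List.mem_cons_self hrC
  have := three_le_fat hpU hqU hrU hpq hpr hqr hp2 hq2 hr2
  omega

include h1 h2 h4 hall hw4 in
/-- **Three fat points: every line passes through one of them** (the three lines through them placed after a line
avoiding them are all free and bring three fat points). -/
theorem through_of_three_fat {p q r : β} (hp2 : w p = 2) (hq2 : w q = 2) (hr2 : w r = 2) (hpq : p ≠ q)
    (hpr : p ≠ r) (hqr : q ≠ r) {A B C : Finset β} (hA : A ∈ ls) (hpA : p ∈ A) (hB : B ∈ ls) (hqB : q ∈ B)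
    (hC : C ∈ ls) (hrC : r ∈ C) {Z : Finset β} (hZ : Z ∈ ls) : p ∈ Z ∨ q ∈ Z ∨ r ∈ Z := by
  by_contra hc
  have hpZ : p ∉ Z := fun h => hc (Or.inl h)
  have hqZ : q ∉ Z := fun h => hc (Or.inr (Or.inl h))
  have hrZ : r ∉ Z := fun h => hc (Or.inr (Or.inr h))
  have hnot : ∀ L ∈ ls, ∀ x y : β, x ∈ L → y ∈ L → x ≠ y → w x = 2 → w y = 2 → False := fun L hL x y hx hy hxy hx2 hy2 =>
    two_fat_false (h1 L hL) (hw4 L hL) (by rw [hall L hL]) hx hy hxy hx2 hy2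
  have hqA : q ∉ A := fun h => hnot A hA p q hpA h hpq hp2 hq2
  have hrA : r ∉ A := fun h => hnot A hA p r hpA h hpr hp2 hr2
  have hrB : r ∉ B := fun h => hnot B hB q r hqB h hqr hq2 hr2
  have hZA : Z ≠ A := fun h => hpZ (h ▸ hpA)
  have hZB : Z ≠ B := fun h => hqZ (h ▸ hqB)
  have hZC : Z ≠ C := fun h => hrZ (h ▸ hrC)
  have hAB : A ≠ B := fun h => hqA (h ▸ hqB)
  have hAC : A ≠ C := fun h => hrA (h ▸ hrC)
  have hBC : B ≠ C := fun h => hrB (h ▸ hrC)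
  have h := budget_six h1 h2 h4 hall [C, B, A, Z] (by simp [hZA.symm, hZB.symm, hZC.symm, hAB.symm, hAC.symm, hBC.symm])
    (by simp [hA, hB, hC, hZ])
  have hnsZ : ¬ Z ⊆ ∅ := fun hsub => by
    have h0 := Finset.card_le_card hsub
    rw [Finset.card_empty] at h0
    have := hall Z hZ
    omega
  rw [freeCountR_cons_of_new hrC (Finset.notMem_empty r) (fun L hL hrL => by
      simp only [List.mem_cons, List.not_mem_nil, or_false] at hL
      rcases hL with hL | hL | hL
      · exact hrB (hL ▸ hrL)
      · exact hrA (hL ▸ hrL)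
      · exact hrZ (hL ▸ hrL)),
    freeCountR_cons_of_new hqB (Finset.notMem_empty q) (fun L hL hqL => by
      simp only [List.mem_cons, List.not_mem_nil, or_false] at hL
      rcases hL with hL | hL
      · exact hqA (hL ▸ hqL)
      · exact hqZ (hL ▸ hqL)),
    freeCountR_cons_of_new hpA (Finset.notMem_empty p) (fun L hL hpL => by
      simp only [List.mem_cons, List.not_mem_nil, or_false] at hL
      exact hpZ (hL ▸ hpL))] at h
  simp only [freeCountR, unionLR, if_neg hnsZ] at h
  have hpU : p ∈ unionLR ∅ [C, B, A, Z] :=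
    mem_unionLR_of_mem (List.mem_cons_of_mem _ (List.mem_cons_of_mem _ List.mem_cons_self)) hpA
  have hqU : q ∈ unionLR ∅ [C, B, A, Z] := mem_unionLR_of_mem (List.mem_cons_of_mem _ List.mem_cons_self) hqB
  have hrU : r ∈ unionLR ∅ [C, B, A, Z] := mem_unionLR_of_mem List.mem_cons_self hrC
  have := three_le_fat hpU hqU hrU hpq hpr hqr hp2 hq2 hr2
  simp only [unionLR] at this
  omega

include h1 h2 h4 hall hw4 in
/-- **Four fat points are impossible**: their four lines are free and cost `4 + 4`. -/
theorem not_four_fat {p q r s : β} (hp2 : w p = 2) (hq2 : w q = 2) (hr2 : w r = 2) (hs2 : w s = 2) (hpq : p ≠ q)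
    (hpr : p ≠ r) (hps : p ≠ s) (hqr : q ≠ r) (hqs : q ≠ s) (hrs : r ≠ s) {A B C D : Finset β} (hA : A ∈ ls)
    (hpA : p ∈ A) (hB : B ∈ ls) (hqB : q ∈ B) (hC : C ∈ ls) (hrC : r ∈ C) (hD : D ∈ ls) (hsD : s ∈ D) : False := by
  have hnot : ∀ L ∈ ls, ∀ x y : β, x ∈ L → y ∈ L → x ≠ y → w x = 2 → w y = 2 → False := fun L hL x y hx hy hxy hx2 hy2 =>
    two_fat_false (h1 L hL) (hw4 L hL) (by rw [hall L hL]) hx hy hxy hx2 hy2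
  have hqA : q ∉ A := fun h => hnot A hA p q hpA h hpq hp2 hq2
  have hrA : r ∉ A := fun h => hnot A hA p r hpA h hpr hp2 hr2
  have hsA : s ∉ A := fun h => hnot A hA p s hpA h hps hp2 hs2
  have hrB : r ∉ B := fun h => hnot B hB q r hqB h hqr hq2 hr2
  have hsB : s ∉ B := fun h => hnot B hB q s hqB h hqs hq2 hs2
  have hsC : s ∉ C := fun h => hnot C hC r s hrC h hrs hr2 hs2
  have hAB : A ≠ B := fun h => hqA (h ▸ hqB)
  have hAC : A ≠ C := fun h => hrA (h ▸ hrC)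
  have hAD : A ≠ D := fun h => hsA (h ▸ hsD)
  have hBC : B ≠ C := fun h => hrB (h ▸ hrC)
  have hBD : B ≠ D := fun h => hsB (h ▸ hsD)
  have hCD : C ≠ D := fun h => hsC (h ▸ hsD)
  have h := budget_six h1 h2 h4 hall [D, C, B, A] (by simp [hAB.symm, hAC.symm, hAD.symm, hBC.symm, hBD.symm, hCD.symm])
    (by simp [hA, hB, hC, hD])
  have hnsA : ¬ A ⊆ ∅ := fun hsub => by
    have h0 := Finset.card_le_card hsub
    rw [Finset.card_empty] at h0
    have := hall A hA
    omega
  rw [freeCountR_cons_of_new hsD (Finset.notMem_empty s) (fun L hL hsL => by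
      simp only [List.mem_cons, List.not_mem_nil, or_false] at hL
      rcases hL with hL | hL | hL
      · exact hsC (hL ▸ hsL)
      · exact hsB (hL ▸ hsL)
      · exact hsA (hL ▸ hsL)),
    freeCountR_cons_of_new hrC (Finset.notMem_empty r) (fun L hL hrL => by
      simp only [List.mem_cons, List.not_mem_nil, or_false] at hL
      rcases hL with hL | hL
      · exact hrB (hL ▸ hrL)
      · exact hrA (hL ▸ hrL)),
    freeCountR_cons_of_new hqB (Finset.notMem_empty q) (fun L hL hqL => by
      simp only [List.mem_cons, List.not_mem_nil, or_false] at hL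
      exact hqA (hL ▸ hqL))] at h
  simp only [freeCountR, unionLR, if_neg hnsA] at h
  have hsub : {p, q, r, s} ⊆ (D ∪ (C ∪ (B ∪ (A ∪ ∅)))).filter (fun v => w v = 2) := by
    intro u hu
    simp only [Finset.mem_insert, Finset.mem_singleton] at hu
    rcases hu with rfl | rfl | rfl | rfl
    · exact Finset.mem_filter.2 ⟨by simp [hpA], hp2⟩
    · exact Finset.mem_filter.2 ⟨by simp [hqB], hq2⟩
    · exact Finset.mem_filter.2 ⟨by simp [hrC], hr2⟩
    · exact Finset.mem_filter.2 ⟨by simp [hsD], hs2⟩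
  have hcard := Finset.card_le_card hsub
  rw [Finset.card_insert_of_notMem (by simp [hpq, hpr, hps]), Finset.card_insert_of_notMem (by simp [hqr, hqs]),
    Finset.card_pair hrs] at hcard
  unfold fat at h
  omega

include h1 h2 h3 h4 hall hw4 in
/-- **No big line, weights `≤ 4`: cap sum `≤ 16`** — by the number of fat points (`0, 1, 2, 3`; four impossible). -/
theorem sum_cap_le_sixteen_of_thin : ∑ L ∈ ls, capPaper L.card (fat w L) ≤ 16 := by
  have hT3 : ∀ L ∈ ls, L.card = 3 ∧ (L ∩ (∅ : Finset β)).card ≤ 1 := fun L hL => by simp [hall L hL]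
  have hB : ∀ l : List (Finset β), l.Nodup → (∀ L ∈ l, L ∈ ls) → freeCountR ∅ l + fat w (unionLR ∅ l) ≤ 6 :=
    fun l hnd hl => budget_six h1 h2 h4 hall l hnd hl
  have hpP : ∀ p : β, p ∉ (∅ : Finset β) := fun p => Finset.notMem_empty p
  have hnot : ∀ L ∈ ls, ∀ x y : β, x ∈ L → y ∈ L → x ≠ y → w x = 2 → w y = 2 → False := fun L hL x y hx hy hxy hx2 hy2 =>
    two_fat_false (h1 L hL) (hw4 L hL) (by rw [hall L hL]) hx hy hxy hx2 hy2
  rw [sum_cap_eq_card_add_sum_fat hall h1 hw4, sum_fat_eq_sum_deg]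
  -- budget `4` or `5` on the free count over a line `A`, according to the fat points it carries
  have hover' : ∀ A ∈ ls, ∀ k : ℕ, (∀ l : List (Finset β), l.Nodup → (∀ L ∈ l, L ∈ ls.erase A) →
      freeCountR A l + fat w (unionLR A l) ≤ 5) → (∀ l : List (Finset β), l.Nodup → (∀ L ∈ l, L ∈ ls.erase A) →
      k + fat w (unionLR A l) ≥ 5) → 2 * ls.card ≤ 2 + k * (k + 1) := by
    intro A hA k hb hf
    exact hover h3 hall A hA k (fun l hnd hl => by have := hb l hnd hl; have := hf l hnd hl; omega)
  have hline : ∀ A ∈ ls, ∀ l : List (Finset β), l.Nodup → (∀ L ∈ l, L ∈ ls.erase A) →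
      freeCountR A l + fat w (unionLR A l) ≤ 5 := fun A hA l hnd hl =>
    budget_line h1 h2 h4 hall hA l hnd (fun h => (Finset.mem_erase.1 (hl A h)).1 rfl)
      (fun L hL => (Finset.mem_erase.1 (hl L hL)).2)
  rcases (by omega : (fatPoints w ls).card = 0 ∨ (fatPoints w ls).card = 1 ∨ (fatPoints w ls).card = 2 ∨
      (fatPoints w ls).card = 3 ∨ 3 < (fatPoints w ls).card) with h0 | hone | htwo | hthree | hfour
  · -- no fat point: `≤ 16` lines
    rw [Finset.card_eq_zero.1 h0, Finset.sum_empty]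
    rcases Finset.eq_empty_or_nonempty ls with hempty | ⟨L₀, hL₀⟩
    · subst hempty; simp
    have h := hover' L₀ hL₀ 5 (hline L₀ hL₀) (fun l _ _ => by omega)
    omega
  · -- one fat point `p` on `A`: `≤ 11` lines, `≤ 5` through `p`
    obtain ⟨p, hp⟩ := Finset.card_eq_one.1 hone
    have hpF : p ∈ fatPoints w ls := hp ▸ Finset.mem_singleton_self p
    obtain ⟨⟨A, hA, hpA⟩, hp2⟩ := mem_fatPoints.1 hpF
    rw [hp, Finset.sum_singleton]
    have hdeg := deg_fat_le hT3 h3 hB (hpP p) hp2 hA hpA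
    have h := hover' A hA 4 (hline A hA) (fun l _ _ => by
      have := one_le_fat (subset_unionLR A l hpA) hp2; omega)
    omega
  · -- two fat points `p, q`: `≤ 3` lines through each, `≤ 7` lines
    obtain ⟨p, q, hpq, hpq'⟩ := Finset.card_eq_two.1 htwo
    have hpF : p ∈ fatPoints w ls := hpq' ▸ Finset.mem_insert_self p {q}
    have hqF : q ∈ fatPoints w ls := hpq' ▸ Finset.mem_insert_of_mem (Finset.mem_singleton_self q)
    obtain ⟨⟨A, hA, hpA⟩, hp2⟩ := mem_fatPoints.1 hpF
    obtain ⟨⟨B, hB', hqB⟩, hq2⟩ := mem_fatPoints.1 hqF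
    rw [hpq', Finset.sum_pair hpq]
    have hdegp := deg_fat_le_of_two hT3 h3 h1 hw4 hB (hpP p) (hpP q) hp2 hq2 hpq hA hpA hB' hqB
    have hdegq := deg_fat_le_of_two hT3 h3 h1 hw4 hB (hpP q) (hpP p) hq2 hp2 hpq.symm hB' hqB hA hpA
    have hqA : q ∉ A := fun h => hnot A hA p q hpA h hpq hp2 hq2
    -- the lines beside `A` avoiding `q`: free budget `2` over `A`
    have hsplit := Finset.card_filter_add_card_filter_not (s := ls.erase A) (fun L => q ∈ L)
    have hthrough : ((ls.erase A).filter (fun L => q ∈ L)).card ≤ (ls.filter (fun L => q ∈ L)).card :=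
      Finset.card_le_card (fun L hL => Finset.mem_filter.2 ⟨(Finset.mem_erase.1 (Finset.mem_filter.1 hL).1).2,
        (Finset.mem_filter.1 hL).2⟩)
    have havoid := two_mul_card_le_of_freeCountR A 2 ((ls.erase A).filter (fun L => q ∉ L))
      (fun L hL => ⟨hall L (Finset.mem_erase.1 (Finset.mem_filter.1 hL).1).2,
        h3 L (Finset.mem_erase.1 (Finset.mem_filter.1 hL).1).2 A hA (Finset.mem_erase.1 (Finset.mem_filter.1 hL).1).1⟩)
      (fun L hL L' hL' hne => h3 L (Finset.mem_erase.1 (Finset.mem_filter.1 hL).1).2 L'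
        (Finset.mem_erase.1 (Finset.mem_filter.1 hL').1).2 hne)
      (fun l hnd hl => by
        have hql : ∀ L ∈ l, q ∉ L := fun L hL => (Finset.mem_filter.1 (hl L hL)).2
        have hBl : B ∉ l := fun h => hql B h hqB
        have h := hline A hA (B :: l) (List.nodup_cons.2 ⟨hBl, hnd⟩) (fun L hL => by
          rcases List.mem_cons.1 hL with rfl | hL
          · exact Finset.mem_erase.2 ⟨fun h => hqA (h ▸ hqB), hB'⟩
          · exact (Finset.mem_filter.1 (hl L hL)).1)
        rw [freeCountR_cons_of_new hqB hqA hql] at h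
        have := two_le_fat (S := unionLR A (B :: l)) (subset_unionLR A _ hpA)
          (mem_unionLR_of_mem List.mem_cons_self hqB) hpq hp2 hq2
        omega)
    rw [Finset.card_erase_of_mem hA] at hsplit
    have := Finset.card_pos.2 ⟨A, hA⟩
    omega
  · -- three fat points: `≤ 1` line through each, every line through one of them
    obtain ⟨p, q, r, hpq, hpr, hqr, hpqr⟩ := Finset.card_eq_three.1 hthree
    have hpF : p ∈ fatPoints w ls := hpqr ▸ Finset.mem_insert_self p {q, r}
    have hqF : q ∈ fatPoints w ls := hpqr ▸ Finset.mem_insert_of_mem (Finset.mem_insert_self q {r})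
    have hrF : r ∈ fatPoints w ls := hpqr ▸ Finset.mem_insert_of_mem (Finset.mem_insert_of_mem (Finset.mem_singleton_self r))
    obtain ⟨⟨A, hA, hpA⟩, hp2⟩ := mem_fatPoints.1 hpF
    obtain ⟨⟨B, hB', hqB⟩, hq2⟩ := mem_fatPoints.1 hqF
    obtain ⟨⟨C, hC, hrC⟩, hr2⟩ := mem_fatPoints.1 hrF
    rw [hpqr, Finset.sum_insert (by simp [hpq, hpr]), Finset.sum_pair hqr]
    have hdp := deg_le_one_of_three_fat h1 h2 h3 h4 hall hw4 hp2 hq2 hr2 hpq hpr hqr hB' hqB hC hrC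
    have hdq := deg_le_one_of_three_fat h1 h2 h3 h4 hall hw4 hq2 hp2 hr2 hpq.symm hqr hpr hA hpA hC hrC
    have hdr := deg_le_one_of_three_fat h1 h2 h3 h4 hall hw4 hr2 hp2 hq2 hpr.symm hqr.symm hpq hA hpA hB' hqB
    have hsub : ls ⊆ ls.filter (fun L => p ∈ L) ∪ (ls.filter (fun L => q ∈ L) ∪ ls.filter (fun L => r ∈ L)) := by
      intro Z hZ
      rcases through_of_three_fat h1 h2 h4 hall hw4 hp2 hq2 hr2 hpq hpr hqr hA hpA hB' hqB hC hrC hZ with h | h | h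
      · exact Finset.mem_union_left _ (Finset.mem_filter.2 ⟨hZ, h⟩)
      · exact Finset.mem_union_right _ (Finset.mem_union_left _ (Finset.mem_filter.2 ⟨hZ, h⟩))
      · exact Finset.mem_union_right _ (Finset.mem_union_right _ (Finset.mem_filter.2 ⟨hZ, h⟩))
    have hc := Finset.card_le_card hsub
    have hu1 := Finset.card_union_le (ls.filter (fun L => p ∈ L)) (ls.filter (fun L => q ∈ L) ∪ ls.filter (fun L => r ∈ L))
    have hu2 := Finset.card_union_le (ls.filter (fun L => q ∈ L)) (ls.filter (fun L => r ∈ L))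
    omega
  · -- four fat points: impossible
    exfalso
    obtain ⟨p, hpF, q, hqF, r, hrF, hpq, hpr, hqr⟩ := Finset.two_lt_card.1 (by omega : 2 < (fatPoints w ls).card)
    -- a fourth fat point beside `p, q, r`
    have hsub : {p, q, r} ⊆ fatPoints w ls := by
      intro u hu
      simp only [Finset.mem_insert, Finset.mem_singleton] at hu
      rcases hu with rfl | rfl | rfl
      · exact hpF
      · exact hqF
      · exact hrF
    obtain ⟨s, hsF, hs⟩ : ∃ s ∈ fatPoints w ls, s ∉ ({p, q, r} : Finset β) := by
      by_contra hc
      have : fatPoints w ls ⊆ {p, q, r} := fun u hu => by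
        by_contra h
        exact hc ⟨u, hu, h⟩
      have := Finset.card_le_card this
      rw [Finset.card_insert_of_notMem (by simp [hpq, hpr]), Finset.card_pair hqr] at this
      omega
    simp only [Finset.mem_insert, Finset.mem_singleton, not_or] at hs
    obtain ⟨⟨A, hA, hpA⟩, hp2⟩ := mem_fatPoints.1 hpF
    obtain ⟨⟨B, hB', hqB⟩, hq2⟩ := mem_fatPoints.1 hqF
    obtain ⟨⟨C, hC, hrC⟩, hr2⟩ := mem_fatPoints.1 hrF
    obtain ⟨⟨D, hD, hsD⟩, hs2⟩ := mem_fatPoints.1 hsF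
    exact not_four_fat h1 h2 h4 hall hw4 hp2 hq2 hr2 hs2 hpq hpr (Ne.symm hs.1) hqr (Ne.symm hs.2.1) (Ne.symm hs.2.2)
      hA hpA hB' hqB hC hrC hD hsD

end Thin6

end FourCap

end S1

end PercRepro
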